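import Literature.RingTheory.MvPowerSeries.OptionEquivLeft
import Literature.AlgebraicGeometry.Resolution.PowerSeriesRegularLocal
import Summits.ResolutionOfSingularities.ResolutionOfSingularities.Theorems.WeightedInvariantLocalWeightedDropNCResBadDirForms

/-! # W4.3 `LocalWeightedDrop` — the directrix cut, wild core `W₃` in GOOD position: THE WEIERSTRASS WITNESS (sorry-free)
[OURS · L1 W4.3 · crux stmt-ResolutionOfSingularities-8899 · author res-L1-w43-strat-1 (gen 9), for verbatim filing by a prover seat as
`Theorems/WeightedInvariantLocalWeightedDropNCDirectrixCutWeierstrass.lean` (`--supports stmt-ResolutionOfSingularities-8899 --as helper`);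
nothing of any manuscript; folklore commutative algebra over Mathlib; AI-produced, gate-checked, weaker than expert review.]

Sub-skeleton `w3_split_v3` of the line `directrix-cut` (evidence on stmt-…-8899, sha16 abfa3a10163d90dc) cuts the wild core `CoreUnaryWild p k 3`
(…NCDirectrixCutPhase) by `(p, o)` and boundary position; its GOOD corner `(p, o) = (2, 2)`, `Decoration.GoodDir` (…NCResRegimeDefs) is fed by the stub
`stub_weierstrassWitnessOfGood`: a legal count move `Φ` keeping every boundary letter a coordinate hyperplane off the slot `0` and presenting
`Φ^* f = u · (x₀² + f₁ x₀ + f₂)` with `u` a unit and `f₁, f₂` free of `x₀`.  THIS FILE PROVES IT, for every `m` and every order `o`: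

1. `Decoration.exists_perm_of_goodDir` — in good position (`O = ∅`, directrix form `ℓ` with a boundary-free slot `j`, `ℓ_j ≠ 0`, i.e.
   `coeff x_j^o f ≠ 0` by `IsDirForm.apply_eq_zero_iff_coeff`) the transposition `x_0 ↔ x_j` is a legal count move (`isLegal_X_perm`) sending every
   boundary letter to a non-zero slot and making `f` `x₀`-REGULAR OF ORDER `o`; packaged with the order as `Decoration.exists_regularMove_of_goodDir`.
2. `exists_weierstrass_of_regular` — WEIERSTRASS PREPARATION IN THE SLOT `0`: an `x₀`-regular `F` of order `o` is `u · (x₀^o + Σ_{i<o} a_i x₀^i)`,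
   `u` a unit, `a_i` free of `x₀` (Mathlib `PowerSeries.exists_isWeierstrassFactorization` over the complete local ring `A = k⟦x_1, …, x_m⟧` —
   complete by Mathlib's `IsAdicComplete (span (range X))` and `maximalIdeal_mvPowerSeries_eq_span` — transported along
   `k⟦x_0, …, x_m⟧ ≅ A⟦T⟧`, `x_0 ↦ T` (`MvPowerSeries.renameEquiv k (finSuccEquiv m)` followed by `Literature.RingTheory.MvPowerSeries.optionEquivLeft`)).
3. `Decoration.exists_weierstrassWitness_of_goodDir` (general `m`, `o`) and `Decoration.exists_weierstrassWitness_two` (`o = 2`, the literal output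
   shape of the stub): the registered-shape stub follows by `fun k _ _ _ b δ hadm _ hO ho hg => Decoration.exists_weierstrassWitness_two hadm.2.1.ne_zero ho hg`.

After this file the GOOD corner of `W₃` rests on ONE stub, `stub_charTwoDoublePointsWeierstrass` = the Cossart–Piltant engine for `h = X² + f₁X + f₂`
over `k⟦u₁,u₂,u₃⟧` in characteristic `2` ([CossartPiltant2019], arXiv:1412.0868, Thm 1.4 / Thm 5.1, valuation-independent form Def 2.18). -/

set_option linter.dupNamespace false -- mandated namespace of this single-conjunct summit

namespace Summit.ResolutionOfSingularities.ResolutionOfSingularities.Theorems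

namespace TameFourTupleDrop

open MvPowerSeries Literature.AlgebraicGeometry.Resolution

variable {k : Type} [Field k] {m : ℕ}

/-! ## 1. Good position ⇒ an `x₀`-regular presentation by a transposition of coordinates -/


/-- A permutation of the coordinates is a legal count move: zero constant terms and linear part the permutation matrix (determinant `±1`). -/
theorem isLegal_X_perm (σ : Equiv.Perm (Fin (m + 1))) :
    (∀ i, constantCoeff ((fun i => (X (σ i) : MvPowerSeries (Fin (m + 1)) k)) i) = 0) ∧
      IsUnit (Matrix.det (Matrix.of fun i j : Fin (m + 1) =>
        coeff (Finsupp.single j 1) ((fun i => (X (σ i) : MvPowerSeries (Fin (m + 1)) k)) i))) := by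
  classical
  refine ⟨fun i => constantCoeff_X _, ?_⟩
  have hM : (Matrix.of fun i j : Fin (m + 1) => coeff (Finsupp.single j 1) (X (σ i) : MvPowerSeries (Fin (m + 1)) k)) =
      σ.permMatrix k := by
    ext i j
    rw [Matrix.of_apply, coeff_index_single_X, Equiv.Perm.permMatrix, PEquiv.toMatrix_apply, Equiv.toPEquiv_apply]
    by_cases h : j = σ i
    · subst h
      simp
    · have h' : ¬ (j ∈ some (σ i)) := by
        rw [Option.mem_def, Option.some.injEq]
        exact fun e => h e.symm
      rw [if_neg h, if_neg h']
  rw [hM, Matrix.det_permutation]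
  rcases Int.units_eq_one_or (Equiv.Perm.sign σ) with h | h <;> simp [h]

/-- **GOOD POSITION ⇒ A TRANSPOSITION MAKES `f` `x₀`-REGULAR OF ORDER `o` AND MOVES EVERY BOUNDARY LETTER OFF THE SLOT `0`.**
With `O = ∅` the directrix form `ℓ` of `in_o f = λ·ℓ^o` has a boundary-free slot `j` with `ℓ_j ≠ 0`, i.e. `coeff x_j^o f ≠ 0`; swap `x_0 ↔ x_j`. -/
theorem Decoration.exists_perm_of_goodDir {δ : Decoration k m} (hg : δ.GoodDir) (ho : δ.o ≠ 0) :
    ∃ σ : Equiv.Perm (Fin (m + 1)), (∀ l ∈ δ.E, σ l ≠ 0) ∧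
      coeff (Finsupp.single 0 δ.o) (subst (fun i => (X (σ i) : MvPowerSeries (Fin (m + 1)) k)) δ.f) ≠ 0 := by
  classical
  obtain ⟨hO, ℓ, hℓ, j, hjE, hℓj⟩ := hg
  have hc : δ.c = δ.o := by rw [Decoration.c, hO, Finset.card_empty, Nat.add_zero]
  have hc0 : δ.c ≠ 0 := by rw [hc]; exact ho
  have hcoef : coeff (Finsupp.single j δ.o) δ.f ≠ 0 := by
    have h : ¬ coeff (Finsupp.single j δ.c) (δ.f * ∏ x ∈ δ.O, X x) = 0 := fun h0 => hℓj ((hℓ.apply_eq_zero_iff_coeff hc0 j).mpr h0)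
    rwa [hO, Finset.prod_empty, mul_one, hc] at h
  refine ⟨Equiv.swap j 0, fun l hl h => ?_, ?_⟩
  · rw [Equiv.swap_apply_eq_iff, Equiv.swap_apply_right] at h
    exact hjE (h ▸ hl)
  · have key := coeff_embDomain_rename (R := k) (Equiv.swap j (0 : Fin (m + 1))).toEmbedding δ.f (Finsupp.single j δ.o)
    rw [Finsupp.embDomain_single, Equiv.toEmbedding_apply, Equiv.swap_apply_left] at key
    have hsub : subst (fun i => (X ((Equiv.swap j (0 : Fin (m + 1))) i) : MvPowerSeries (Fin (m + 1)) k)) δ.f =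
        rename (⇑(Equiv.swap j (0 : Fin (m + 1))).toEmbedding) δ.f :=
      (rename_eq_subst _ δ.f).symm
    rw [hsub, key]
    exact hcoef

/-- The same, packaged as the LEGAL-MOVE DATA of `stub_weierstrassWitnessOfGood` (sub-skeleton `w3_split_v3`): a legal `Φ` (here a transposition of
coordinates) with every boundary letter `Φ l = v · X l'`, `l' ≠ 0`, `v` a unit, such that `Φ^* f` is `x₀`-regular of order `o = ord f = ord Φ^* f`. -/
theorem Decoration.exists_regularMove_of_goodDir {δ : Decoration k m} (hg : δ.GoodDir) (ho : δ.o ≠ 0) :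
    ∃ Φ : Fin (m + 1) → MvPowerSeries (Fin (m + 1)) k,
      (∀ i, constantCoeff (Φ i) = 0) ∧
      IsUnit (Matrix.det (Matrix.of fun i j : Fin (m + 1) => coeff (Finsupp.single j 1) (Φ i))) ∧
      (∀ l ∈ δ.E, ∃ (l' : Fin (m + 1)) (v : MvPowerSeries (Fin (m + 1)) k), l' ≠ 0 ∧ constantCoeff v ≠ 0 ∧ Φ l = v * X l') ∧
      (subst Φ δ.f).order = δ.f.order ∧
      coeff (Finsupp.single 0 δ.o) (subst Φ δ.f) ≠ 0 := by
  obtain ⟨σ, hE, hcoef⟩ := Decoration.exists_perm_of_goodDir hg ho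
  obtain ⟨h0, hdet⟩ := isLegal_X_perm (k := k) σ
  refine ⟨fun i => X (σ i), h0, hdet, fun l hl => ⟨σ l, 1, hE l hl, ?_, (one_mul _).symm⟩,
    TOT2E1.order_subst_eq_of_legal _ h0 hdet δ.f, hcoef⟩
  rw [map_one]
  exact one_ne_zero


/-! ## 2. Weierstrass preparation in the slot `0` -/


/-- **WEIERSTRASS PREPARATION IN THE SLOT `0`.**  If `F ∈ k⟦x_0, …, x_m⟧` is `x₀`-regular of order `o` (`coeff x₀^i F = 0` for `i < o`,
`coeff x₀^o F ≠ 0`), then `F = u · (x₀^o + Σ_{i<o} a_i x₀^i)` with `u` a unit and the `a_i` free of `x₀` (Mathlib's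
`PowerSeries.exists_isWeierstrassFactorization` over the complete local ring `A = k⟦x_1, …, x_m⟧`, transported along
`k⟦x_0, …, x_m⟧ ≅ A⟦T⟧`, `x_0 ↦ T`). -/
theorem exists_weierstrass_of_regular {F : MvPowerSeries (Fin (m + 1)) k} {o : ℕ}
    (hlow : ∀ i < o, coeff (Finsupp.single 0 i) F = 0) (hreg : coeff (Finsupp.single 0 o) F ≠ 0) :
    ∃ (u : MvPowerSeries (Fin (m + 1)) k) (a : ℕ → MvPowerSeries (Fin (m + 1)) k),
      constantCoeff u ≠ 0 ∧ (∀ i (n : Fin (m + 1) →₀ ℕ), n 0 ≠ 0 → coeff n (a i) = 0) ∧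
      F = u * (X 0 ^ o + ∑ i ∈ Finset.range o, a i * X 0 ^ i) := by
  classical
  let A := MvPowerSeries (Fin m) k
  let e : MvPowerSeries (Fin (m + 1)) k ≃+* PowerSeries A :=
    ((MvPowerSeries.renameEquiv k (finSuccEquiv m)).toRingEquiv).trans Literature.RingTheory.MvPowerSeries.optionEquivLeft
  haveI : IsAdicComplete (IsLocalRing.maximalIdeal A) A := by
    rw [Literature.AlgebraicGeometry.Resolution.maximalIdeal_mvPowerSeries_eq_span]
    infer_instance
  -- coefficients along the splitting
  have hcoeff : ∀ (G : MvPowerSeries (Fin (m + 1)) k) (i : ℕ) (d : Fin m →₀ ℕ),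
      MvPowerSeries.coeff d (PowerSeries.coeff i (e G)) = MvPowerSeries.coeff (Finsupp.cons i d) G := by
    intro G i d
    have hidx : Finsupp.optionElim i d = Finsupp.embDomain (finSuccEquiv m).toEmbedding (Finsupp.cons i d) := by
      ext j
      cases j with
      | none =>
          have h0 : (none : Option (Fin m)) = (finSuccEquiv m).toEmbedding 0 := (finSuccEquiv_zero).symm
          rw [h0, Finsupp.embDomain_apply]
          simp [Equiv.toEmbedding_apply, finSuccEquiv_zero]
      | some s =>
          have hs : (some s : Option (Fin m)) = (finSuccEquiv m).toEmbedding s.succ := (finSuccEquiv_succ s).symm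
          rw [hs, Finsupp.embDomain_apply]
          simp [Equiv.toEmbedding_apply, finSuccEquiv_succ]
    show MvPowerSeries.coeff d (PowerSeries.coeff i (Literature.RingTheory.MvPowerSeries.optionEquivLeft
      (MvPowerSeries.renameEquiv k (finSuccEquiv m) G))) = _
    rw [Literature.RingTheory.MvPowerSeries.coeff_coeff_optionEquivLeft, MvPowerSeries.renameEquiv_apply, hidx]
    exact MvPowerSeries.coeff_embDomain_rename (finSuccEquiv m).toEmbedding G (Finsupp.cons i d)
  have hcc : ∀ (G : MvPowerSeries (Fin (m + 1)) k) (i : ℕ),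
      MvPowerSeries.constantCoeff (PowerSeries.coeff i (e G)) = coeff (Finsupp.single 0 i) G := by
    intro G i
    rw [← MvPowerSeries.coeff_zero_eq_constantCoeff_apply, hcoeff, Finsupp.cons_zero_eq_single_zero]
  have heX : e (X 0) = PowerSeries.X := by
    show Literature.RingTheory.MvPowerSeries.optionEquivLeft ((MvPowerSeries.renameEquiv k (finSuccEquiv m))
      (X 0 : MvPowerSeries (Fin (m + 1)) k)) = PowerSeries.X
    show Literature.RingTheory.MvPowerSeries.optionEquivLeft (MvPowerSeries.rename (finSuccEquiv m)
      (X 0 : MvPowerSeries (Fin (m + 1)) k)) = PowerSeries.X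
    rw [MvPowerSeries.rename_X, finSuccEquiv_zero]
    exact Literature.RingTheory.MvPowerSeries.optionEquivLeft_X_none
  -- membership of the `T`-coefficients in `𝔪_A`
  have hmem : ∀ i, PowerSeries.coeff i (e F) ∈ IsLocalRing.maximalIdeal A ↔ coeff (Finsupp.single 0 i) F = 0 := by
    intro i
    rw [IsLocalRing.mem_maximalIdeal, mem_nonunits_iff, MvPowerSeries.isUnit_iff_constantCoeff, isUnit_iff_ne_zero,
      not_not, hcc]
  have hmapne : (e F).map (IsLocalRing.residue A) ≠ 0 := by
    intro h0
    have h1 := congrArg (PowerSeries.coeff o) h0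
    rw [PowerSeries.coeff_map, map_zero, IsLocalRing.residue_eq_zero_iff] at h1
    exact hreg ((hmem o).mp h1)
  have horder : ((e F).map (IsLocalRing.residue A)).order = o := by
    rw [PowerSeries.order_eq_nat]
    refine ⟨fun h0 => ?_, fun i hi => ?_⟩
    · rw [PowerSeries.coeff_map, IsLocalRing.residue_eq_zero_iff] at h0
      exact hreg ((hmem o).mp h0)
    · rw [PowerSeries.coeff_map, IsLocalRing.residue_eq_zero_iff]
      exact (hmem i).mpr (hlow i hi)
  -- Weierstrass preparation over `A`
  obtain ⟨f, h, H⟩ := PowerSeries.exists_isWeierstrassFactorization hmapne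
  have hdeg : f.natDegree = o := by
    rw [H.natDegree_eq_toNat_order_map, horder]
    rfl
  have hlead : f.coeff o = 1 := by
    rw [← hdeg]
    exact H.isDistinguishedAt.monic.coeff_natDegree
  have hfsum : (f : PowerSeries A) = PowerSeries.X ^ o + ∑ i ∈ Finset.range o, PowerSeries.C (f.coeff i) * PowerSeries.X ^ i := by
    rw [← Polynomial.eval₂_C_X_eq_coe, Polynomial.eval₂_eq_sum_range, hdeg, Finset.sum_range_succ, hlead, map_one, one_mul,
      add_comm]
  -- transport back
  have hsymmX : e.symm PowerSeries.X = X 0 := by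
    rw [← heX, RingEquiv.symm_apply_apply]
  refine ⟨e.symm h, fun i => e.symm (PowerSeries.C (f.coeff i)), ?_, ?_, ?_⟩
  · have hu : IsUnit (e.symm h) := H.isUnit.map e.symm
    exact isUnit_iff_ne_zero.mp (MvPowerSeries.isUnit_iff_constantCoeff.mp hu)
  · intro i n hn
    have hn' : n = Finsupp.cons (n 0) (Finsupp.tail n) := (Finsupp.cons_tail n).symm
    rw [hn', ← hcoeff, RingEquiv.apply_symm_apply, PowerSeries.coeff_C, if_neg hn, MvPowerSeries.coeff_zero]
  · have hF : F = e.symm ((f : PowerSeries A) * h) := by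
      rw [← H.eq_mul, RingEquiv.symm_apply_apply]
    rw [hF, hfsum, map_mul, map_add, map_pow, map_sum, hsymmX, mul_comm]
    congr 2
    refine Finset.sum_congr rfl fun i _ => ?_
    rw [map_mul, map_pow, hsymmX]


/-! ## 3. The Weierstrass witness of the wild core in good position -/

/-- **THE WEIERSTRASS WITNESS IN GOOD POSITION** (every `m`, every order): a legal count move `Φ` (a transposition of coordinates) with every
boundary letter `Φ l = v · X l'`, `l' ≠ 0`, `v` a unit, and `Φ^* f = u · (x₀^o + Σ_{i<o} a_i x₀^i)`, `u` a unit, the `a_i` free of `x₀`. -/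
theorem Decoration.exists_weierstrassWitness_of_goodDir {δ : Decoration k m} (hf : δ.f ≠ 0) (ho : δ.o ≠ 0) (hg : δ.GoodDir) :
    ∃ (Φ : Fin (m + 1) → MvPowerSeries (Fin (m + 1)) k) (u : MvPowerSeries (Fin (m + 1)) k) (a : ℕ → MvPowerSeries (Fin (m + 1)) k),
      (∀ i, constantCoeff (Φ i) = 0) ∧
      IsUnit (Matrix.det (Matrix.of fun i j : Fin (m + 1) => coeff (Finsupp.single j 1) (Φ i))) ∧
      (∀ l ∈ δ.E, ∃ (l' : Fin (m + 1)) (v : MvPowerSeries (Fin (m + 1)) k), l' ≠ 0 ∧ constantCoeff v ≠ 0 ∧ Φ l = v * X l') ∧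
      constantCoeff u ≠ 0 ∧ (∀ i (n : Fin (m + 1) →₀ ℕ), n 0 ≠ 0 → coeff n (a i) = 0) ∧
      subst Φ δ.f = u * (X 0 ^ δ.o + ∑ i ∈ Finset.range δ.o, a i * X 0 ^ i) := by
  obtain ⟨Φ, h0, hdet, hE, hord, hreg⟩ := Decoration.exists_regularMove_of_goodDir hg ho
  have hfo : δ.f.order = (δ.o : ℕ∞) := by
    rw [Decoration.o, ENat.coe_toNat]
    rw [ne_eq, order_eq_top_iff]
    exact hf
  have hlow : ∀ i < δ.o, coeff (Finsupp.single 0 i) (subst Φ δ.f) = 0 := by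
    intro i hi
    apply coeff_of_lt_order
    rw [hord, hfo, Finsupp.degree_single]
    exact_mod_cast hi
  obtain ⟨u, a, hu, ha, hW⟩ := exists_weierstrass_of_regular hlow hreg
  exact ⟨Φ, u, a, h0, hdet, hE, hu, ha, hW⟩

/-- **Order two**: `Φ^* f = u · (x₀² + f₁ x₀ + f₂)` — the literal output shape of `stub_weierstrassWitnessOfGood` of the sub-skeleton `w3_split_v3`
(there `m + 1 = 4`; the stub's unused binders `[CharP k 2] [IsAlgClosed k]`, `UnaryVertex δ`, `δ.O = ∅` are dropped, `Admissible b δ` enters only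
through `δ.f ≠ 0`). -/
theorem Decoration.exists_weierstrassWitness_two {δ : Decoration k m} (hf : δ.f ≠ 0) (ho : δ.o = 2) (hg : δ.GoodDir) :
    ∃ (Φ : Fin (m + 1) → MvPowerSeries (Fin (m + 1)) k) (u f₁ f₂ : MvPowerSeries (Fin (m + 1)) k),
      (∀ i, constantCoeff (Φ i) = 0) ∧
      IsUnit (Matrix.det (Matrix.of fun i j : Fin (m + 1) => coeff (Finsupp.single j 1) (Φ i))) ∧
      (∀ l ∈ δ.E, ∃ (l' : Fin (m + 1)) (v : MvPowerSeries (Fin (m + 1)) k), l' ≠ 0 ∧ constantCoeff v ≠ 0 ∧ Φ l = v * X l') ∧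
      constantCoeff u ≠ 0 ∧
      (∀ n : Fin (m + 1) →₀ ℕ, n 0 ≠ 0 → coeff n f₁ = 0) ∧ (∀ n : Fin (m + 1) →₀ ℕ, n 0 ≠ 0 → coeff n f₂ = 0) ∧
      subst Φ δ.f = u * (X 0 ^ 2 + f₁ * X 0 + f₂) := by
  obtain ⟨Φ, u, a, h0, hdet, hE, hu, ha, hW⟩ := Decoration.exists_weierstrassWitness_of_goodDir hf (by rw [ho]; exact two_ne_zero) hg
  refine ⟨Φ, u, a 1, a 0, h0, hdet, hE, hu, ha 1, ha 0, ?_⟩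
  rw [hW, ho, Finset.sum_range_succ, Finset.sum_range_succ, Finset.sum_range_zero, pow_zero, pow_one, mul_one, zero_add]
  ring

end TameFourTupleDrop

end Summit.ResolutionOfSingularities.ResolutionOfSingularities.Theorems
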